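import Mathlib
import Summits.ValiantsHypothesis.ValiantsHypothesis.Theorems.KPlusLogSqLawWeakLiftingTowerGraftSkewBlockIdentityCrossings
import Summits.ValiantsHypothesis.ValiantsHypothesis.Theorems.KPlusLogSqLawWeakLiftingTowerGraftSkewBlockBidiagonalTower

/-!
# Tower graft line — IDENTITY-GRAFT PHANTOMS ON GENUINE TOWERS AT EVERY EVEN SIZE (S4's object; `2m` crossings, no eigenvalue event)

Calibration file for the line `Cruxes/WeakLifting/Lines/tower_graft.lean` (crux `WeakLifting` = stmt-ValiantsHypothesis-19561), for the object
of S4 `stub_graftLawId` (far letter the FULL identity at a tower-top exponent, `det(G + X^D·1)`, `IsTower m d`, `m·dₗ < D`).  NO stub is claimed.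
Two steps:

* `skewBlock_identity_crossings_rescaled` — p702623's `skewBlock_identity_crossings` with the normalisation `τ_N < 1` REMOVED: from exactly the
  hypotheses of p689545's `skewBlock_phantoms_square` (square blocks `B(t) = Σₗ t^{dₗ}Bₗ`, interleaved positive points
  `τ₀ < ρ₀ < ⋯ < ρ_{N−1} < τ_N`, `det B(τᵢ) ≠ 0`, `det B(ρᵢ) = 0`, `B″(ρᵢ)` of full column rank), the RESCALED blocks `Λ^{dₗ}Bₗ`
  (`Λ = τ_N + 1`; `B_Λ(t) = B(Λt)`, same support) carry, for every large far exponent `D`, an `η > 0` with `Z₊(det G_η) = 0` and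
  `Z₊(det(G_η + X^D·1)) ≥ 2N` (`sum_pow_smul_rescale`: `Σ (t/Λ)^{dₗ}·Λ^{dₗ}Bₗ = Σ t^{dₗ}Bₗ`).
* `skewBlock_identityGraft_bidiag_tower (q)` — **for every `q` (`m = 2(q+1)`): on the genuine `m`-tower `d = (1, 1+m, 1+(m+1)m)` there are
  three-letter blocks `B`, a far exponent `D` with `m·dₗ < D` and an `η > 0` such that the symmetric skew-block pencil `G_η` of size `m` has
  NO positive root of `det G_η` (no eigenvalue event) while `det(G_η + X^D·1)` has at least `2m = 4(q+1)` distinct positive roots; the tower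
  inequalities are conjuncts of the conclusion.**  The blocks are lift-p2 g19's bidiagonal tower data (p693809 `skewBlock_phantoms_bidiag_tower`:
  superdiagonal `t`, diagonal trinomials in `u = t^m` vanishing exactly at `t = 2r+1, 2r+2`; certificate points `τᵢ = i + ½`, `ρᵢ = i + 1`),
  whose verification is copied verbatim (adapted from `…SkewBlockBidiagonalTower`), then rescaled by `Λ = m + 3/2`.

READING (NO-GO ledger, kill-shape #38⁺, S4 row): «`Z₊(det(G + X^D·1)) ≤ c·#{eigenvalue events of G} + g(m)`» is KERNEL-dead ON GENUINE TOWERS for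
every even `m` and every `g(m) < 2m` (p699141: `m = 6`, `g < 18`; p701122: every `m ∈ 6ℕ⁺`, `g < 3m`, support `(0,1,7)` fixed — a tower only at
`m = 6`).  Inside the class budget (`B ≥ ζ₊(m; d) ≥ C(m+2,2) − 1 > 2m`), so ZERO crux credit: S4 at `C = 1` pays on this family.
HONEST FRAMING: explicit algebra + p702623's sign-persistence mechanism; nothing on S4/S4b/S5/S5ᴸ, TowerB, `WeakLifting`, Conjecture B,
`MatrixDescartes` (18050) or `VP ≠ VNP`.  Def-free.  Seat: prover val-sym-lift-p2 g20, `--supports stmt-ValiantsHypothesis-19561`.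
-/

-- `Summit.ValiantsHypothesis.ValiantsHypothesis.…` repeats a component by the D-0017 layout
-- (single-conjunct summit), which the `dupNamespace` linter flags; the name is mandated.
set_option linter.dupNamespace false

namespace Summit.ValiantsHypothesis.ValiantsHypothesis.Theorems.KPlusLogSqLaw.TowerGraft

open Polynomial Matrix
open scoped BigOperators Polynomial

section IdentityGraftTower

/-- rescaling the variable: `Σₗ (t/Λ)^{dₗ} · (Λ^{dₗ} Bₗ) = Σₗ t^{dₗ} Bₗ` (`Λ ≠ 0`). [folklore] -/
theorem sum_pow_smul_rescale {K : ℕ} {n : Type*} (d : Fin K → ℕ) (B : Fin K → Matrix n n ℝ) (Λ t : ℝ) (hΛ : Λ ≠ 0) :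
    (∑ l, (t / Λ) ^ d l • (Λ ^ d l • B l)) = ∑ l, t ^ d l • B l := by
  refine Finset.sum_congr rfl fun l _ => ?_
  rw [smul_smul, div_pow, div_mul_cancel₀ _ (pow_ne_zero _ hΛ)]

/-- **the identity-graft mechanism without the normalisation `τ_N < 1`**: under exactly the hypotheses of p689545's
`skewBlock_phantoms_square`, the rescaled blocks `(τ_N + 1)^{dₗ}·Bₗ` give, for every large far exponent `D`, an `η > 0` with no positive
root of `det G_η` and at least `2N` positive roots of `det(G_η + X^D·1)`. [this work] -/
theorem skewBlock_identity_crossings_rescaled {q K : ℕ} (d : Fin K → ℕ) (l₀ : Fin K)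
    (B : Fin K → Matrix (Fin (q + 1)) (Fin (q + 1)) ℝ) (j : Fin (q + 1)) (N : ℕ) (τ ρ : ℕ → ℝ) (hτρ : ∀ i, τ i < ρ i)
    (hρτ : ∀ i, ρ i < τ (i + 1)) (hτpos : ∀ i, 0 < τ i)
    (hτB : ∀ i, i ≤ N → (∑ l, τ i ^ d l • B l).det ≠ 0)
    (hρB : ∀ i, i < N → (∑ l, ρ i ^ d l • B l).det = 0)
    (hρB'' : ∀ i, i < N → (((∑ l, ρ i ^ d l • B l).submatrix id j.succAbove)ᵀ *
      ((∑ l, ρ i ^ d l • B l).submatrix id j.succAbove)).det ≠ 0) :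
    ∃ D₀ : ℕ, ∀ D : ℕ, D₀ ≤ D → ∃ η : ℝ, 0 < η ∧
      ((∑ l, (X : ℝ[X]) ^ d l • (Matrix.fromBlocks (if l = l₀ then η • (1 : Matrix (Fin (q + 1)) (Fin (q + 1)) ℝ) else 0)
        ((τ N + 1) ^ d l • B l) ((τ N + 1) ^ d l • B l)ᵀ
        (if l = l₀ then -(η • (1 : Matrix (Fin (q + 1)) (Fin (q + 1)) ℝ)) else 0)).map C).det.roots.toFinset.filter
        (fun t => 0 < t)).card = 0 ∧
      2 * N ≤ (((∑ l, (X : ℝ[X]) ^ d l • (Matrix.fromBlocks (if l = l₀ then η • (1 : Matrix (Fin (q + 1)) (Fin (q + 1)) ℝ) else 0)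
          ((τ N + 1) ^ d l • B l) ((τ N + 1) ^ d l • B l)ᵀ
          (if l = l₀ then -(η • (1 : Matrix (Fin (q + 1)) (Fin (q + 1)) ℝ)) else 0)).map C) +
        (X : ℝ[X]) ^ D • (1 : Matrix (Fin (q + 1) ⊕ Fin (q + 1)) (Fin (q + 1) ⊕ Fin (q + 1)) ℝ[X])).det.roots.toFinset.filter
        (fun t => 0 < t)).card := by
  have hΛ : 0 < τ N + 1 := by linarith [hτpos N]
  have key : ∀ t : ℝ, (∑ l, (t / (τ N + 1)) ^ d l • ((τ N + 1) ^ d l • B l)) = ∑ l, t ^ d l • B l :=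
    fun t => sum_pow_smul_rescale d B (τ N + 1) t hΛ.ne'
  exact skewBlock_identity_crossings d l₀ (fun l => (τ N + 1) ^ d l • B l) j N (fun i => τ i / (τ N + 1))
    (fun i => ρ i / (τ N + 1)) (fun i => div_lt_div_of_pos_right (hτρ i) hΛ) (fun i => div_lt_div_of_pos_right (hρτ i) hΛ)
    (fun i => div_pos (hτpos i) hΛ) (by rw [div_lt_one hΛ]; linarith)
    (fun i hi => by rw [key]; exact hτB i hi) (fun i hi => by rw [key]; exact hρB i hi)
    (fun i hi => by rw [key]; exact hρB'' i hi)

/-- **identity-graft phantoms on genuine towers, every even size** (S4's object; calibration).  For every `q` (`m = 2(q+1)`): on the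
`m`-tower `d = (1, 1+m, 1+(m+1)m)` there are three-letter blocks `B`, a far exponent `D` above the tower (`m·dₗ < D`) and an `η > 0` such that
`det G_η` has NO positive root while `det(G_η + X^D·1)` has at least `2m = 4(q+1)` distinct positive roots.  Data: lift-p2 g19's bidiagonal
tower blocks (p693809), rescaled by `Λ = m + 3/2`. [this work] -/
theorem skewBlock_identityGraft_bidiag_tower (q : ℕ) :
    ∃ (B : Fin 3 → Matrix (Fin (q + 1)) (Fin (q + 1)) ℝ) (D : ℕ) (η : ℝ), 0 < η ∧
      (∀ l l' : Fin 3, l < l' → 2 * (q + 1) * (![1, 1 + 2 * (q + 1), 1 + (2 * (q + 1) + 1) * (2 * (q + 1))] : Fin 3 → ℕ) l <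
        (![1, 1 + 2 * (q + 1), 1 + (2 * (q + 1) + 1) * (2 * (q + 1))] : Fin 3 → ℕ) l') ∧
      (∀ l : Fin 3, 2 * (q + 1) * (![1, 1 + 2 * (q + 1), 1 + (2 * (q + 1) + 1) * (2 * (q + 1))] : Fin 3 → ℕ) l < D) ∧
      ((∑ l, (X : ℝ[X]) ^ (![1, 1 + 2 * (q + 1), 1 + (2 * (q + 1) + 1) * (2 * (q + 1))] : Fin 3 → ℕ) l •
        (Matrix.fromBlocks (if l = 0 then η • (1 : Matrix (Fin (q + 1)) (Fin (q + 1)) ℝ) else 0)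
        (B l) (B l)ᵀ (if l = 0 then -(η • (1 : Matrix (Fin (q + 1)) (Fin (q + 1)) ℝ)) else 0)).map C).det.roots.toFinset.filter
        (fun t => 0 < t)).card = 0 ∧
      4 * (q + 1) ≤ ((((∑ l, (X : ℝ[X]) ^ (![1, 1 + 2 * (q + 1), 1 + (2 * (q + 1) + 1) * (2 * (q + 1))] : Fin 3 → ℕ) l •
          (Matrix.fromBlocks (if l = 0 then η • (1 : Matrix (Fin (q + 1)) (Fin (q + 1)) ℝ) else 0) (B l) (B l)ᵀ
          (if l = 0 then -(η • (1 : Matrix (Fin (q + 1)) (Fin (q + 1)) ℝ)) else 0)).map C) +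
        (X : ℝ[X]) ^ D • (1 : Matrix (Fin (q + 1) ⊕ Fin (q + 1)) (Fin (q + 1) ⊕ Fin (q + 1)) ℝ[X])).det).roots.toFinset.filter
        (fun t => 0 < t)).card := by
  -- adapted from `…Theorems/KPlusLogSqLawWeakLiftingTowerGraftSkewBlockBidiagonalTower.lean` (lift-p2 g19, p693809): the block data and the
  -- verification of p689545's hypotheses are copied; only the mechanism theorem changes.
  obtain ⟨m, hm⟩ : ∃ m : ℕ, m = 2 * (q + 1) := ⟨_, rfl⟩
  obtain ⟨n, hn⟩ : ∃ n : ℕ, n = m + 1 := ⟨_, rfl⟩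
  have hm2 : 2 ≤ m := by omega
  have hm0 : m ≠ 0 := by omega
  -- block root data in `u = t^m`
  set Ar : Fin (q + 1) → ℝ := fun r => ((2 * (r : ℕ) + 1 : ℕ) : ℝ) ^ m with hAr
  set Br : Fin (q + 1) → ℝ := fun r => ((2 * (r : ℕ) + 2 : ℕ) : ℝ) ^ m with hBr
  have hA0 : ∀ r, 0 < Ar r := fun r => by simp only [hAr]; positivity
  have hB0 : ∀ r, 0 < Br r := fun r => by simp only [hBr]; positivity
  have hdiv := fun r => trinomial_division (Ar r) (Br r) (hA0 r) (hB0 r) n (by omega)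
  choose h₁ h₂ hh₂ hle H hH hid using hdiv
  -- the letters: diagonal coefficients `α r = Ar·Br·h₂`, `β r = −h₁`, top `1`; superdiagonal `1` on letter 0
  set B : Fin 3 → Matrix (Fin (q + 1)) (Fin (q + 1)) ℝ :=
    ![Matrix.of (fun r c : Fin (q + 1) => if c = r then Ar r * Br r * h₂ r else if (c : ℕ) = r + 1 then (1 : ℝ) else 0),
      Matrix.diagonal (fun r => -h₁ r), (1 : Matrix (Fin (q + 1)) (Fin (q + 1)) ℝ)] with hB
  set δ : ℝ → Fin (q + 1) → ℝ := fun t r => Ar r * Br r * h₂ r * t + -h₁ r * t ^ (1 + m) + t ^ (1 + n * m) with hδ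
  have hd1 : (![1, 1 + 2 * (q + 1), 1 + (2 * (q + 1) + 1) * (2 * (q + 1))] : Fin 3 → ℕ) 1 = 1 + m := by simp [hm]
  have hd2 : (![1, 1 + 2 * (q + 1), 1 + (2 * (q + 1) + 1) * (2 * (q + 1))] : Fin 3 → ℕ) 2 = 1 + n * m := by simp [hm, hn]
  have hBt : ∀ t : ℝ, (∑ l, t ^ (![1, 1 + 2 * (q + 1), 1 + (2 * (q + 1) + 1) * (2 * (q + 1))] : Fin 3 → ℕ) l • B l) =
      Matrix.of (fun r c : Fin (q + 1) => if c = r then δ t r else if (c : ℕ) = r + 1 then t else 0) := by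
    intro t
    ext r c
    rw [Matrix.sum_apply, Fin.sum_univ_three, hd1, hd2]
    simp only [hB, hδ, Matrix.smul_apply, Matrix.cons_val_zero, Matrix.cons_val_one, Matrix.head_cons, Matrix.cons_val_two,
      Matrix.tail_cons, Matrix.of_apply, Matrix.diagonal_apply, Matrix.one_apply, smul_eq_mul]
    by_cases h1 : c = r
    · subst h1; simp; ring
    · have h2 : ¬ r = c := fun h => h1 h.symm
      by_cases h3 : (c : ℕ) = r + 1
      · simp [h1, h2, h3]
      · simp [h1, h2, h3]
  -- factorisation of the diagonal trinomial: `δ t r = t · (u − Ar)(u − Br)·H r u`, `u = t^m`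
  have hδfac : ∀ t r, δ t r = t * ((t ^ m - Ar r) * (t ^ m - Br r) * H r (t ^ m)) := by
    intro t r
    have e := hid r (t ^ m)
    have e1 : t ^ (1 + m) = t * t ^ m := by rw [pow_add, pow_one]
    have e2 : t ^ (1 + n * m) = t * (t ^ m) ^ n := by rw [pow_add, pow_one, mul_comm n m, pow_mul]
    simp only [hδ]
    rw [e1, e2, ← e]
    ring
  have hdet : ∀ t : ℝ, (∑ l, t ^ (![1, 1 + 2 * (q + 1), 1 + (2 * (q + 1) + 1) * (2 * (q + 1))] : Fin 3 → ℕ) l • B l).det =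
      ∏ r, δ t r := fun t => by rw [hBt, det_bidiag]
  -- the mechanism (p702623, rescaled): `∃ D₀ ∀ D ≥ D₀ ∃ η …` for the blocks `Λ^{dₗ} Bₗ`, `Λ = m + 3/2`
  obtain ⟨D₀, hD₀⟩ := skewBlock_identity_crossings_rescaled
    (![1, 1 + 2 * (q + 1), 1 + (2 * (q + 1) + 1) * (2 * (q + 1))] : Fin 3 → ℕ) 0 B 0 (2 * (q + 1))
    (fun k => (k : ℝ) + 1 / 2) (fun k => (k : ℝ) + 1) (fun k => by simp; norm_num) (fun k => by push_cast; linarith)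
    (fun k => by positivity)
    (fun k hk => by
      rw [hdet]
      refine Finset.prod_ne_zero_iff.mpr fun r _ => ?_
      rw [hδfac]
      have hτ : (0 : ℝ) < (k : ℝ) + 1 / 2 := by positivity
      have hτm : (0 : ℝ) ≤ ((k : ℝ) + 1 / 2) ^ m := by positivity
      refine mul_ne_zero hτ.ne' (mul_ne_zero (mul_ne_zero (sub_ne_zero.mpr ?_) (sub_ne_zero.mpr ?_)) (hH r _ hτm).ne')
      · simp only [hAr]; exact nat_add_half_pow_ne k _ m hm0
      · simp only [hBr]; exact nat_add_half_pow_ne k _ m hm0)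
    (fun k hk => by
      rw [hdet]
      refine Finset.prod_eq_zero (Finset.mem_univ (⟨k / 2, by omega⟩ : Fin (q + 1))) ?_
      rw [hδfac]
      rcases Nat.even_or_odd k with ⟨j, hj⟩ | ⟨j, hj⟩
      · have e1 : (k / 2 : ℕ) = j := by omega
        have e2 : ((k : ℝ) + 1) ^ m - Ar ⟨k / 2, by omega⟩ = 0 := by
          simp only [hAr, e1]; push_cast; rw [hj]; push_cast; ring
        rw [e2]; ring
      · have e1 : (k / 2 : ℕ) = j := by omega
        have e2 : ((k : ℝ) + 1) ^ m - Br ⟨k / 2, by omega⟩ = 0 := by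
          simp only [hBr, e1]; push_cast; rw [hj]; push_cast; ring
        rw [e2]; ring)
    (fun k hk => by
      rw [hBt]
      have hinj := mulVec_injective_bidiag_minor (δ ((k : ℝ) + 1)) (show ((k : ℝ) + 1) ≠ 0 by positivity)
      have hpd := Matrix.PosDef.conjTranspose_mul_self _ hinj
      rw [Matrix.conjTranspose_eq_transpose_of_trivial] at hpd
      exact hpd.det_pos.ne')
  -- a far exponent above both the mechanism's threshold and the tower top
  obtain ⟨η, hη, h1, h2⟩ := hD₀ (max D₀ (2 * (q + 1) * (1 + (2 * (q + 1) + 1) * (2 * (q + 1))) + 1)) (le_max_left _ _)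
  have h2' : 4 * (q + 1) ≤ _ := le_of_eq_of_le (by ring) h2
  refine ⟨_, _, η, hη, ?_, ?_, h1, h2'⟩
  · -- the support is an `m`-tower
    rintro ⟨l, hl⟩ ⟨l', hl'⟩ hll'
    rw [Fin.mk_lt_mk] at hll'
    interval_cases l <;> interval_cases l' <;> first | omega | (simp <;> nlinarith)
  · rintro ⟨l, hl⟩
    refine lt_of_lt_of_le ?_ (le_max_right _ _)
    interval_cases l <;> simp

end IdentityGraftTower

end Summit.ValiantsHypothesis.ValiantsHypothesis.Theorems.KPlusLogSqLaw.TowerGraft
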